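import Mathlib
import Literature.Computability.Complexity.KRWComposition

/-!
# Route KrwChromaticSteering, crux `StrongComposition` (stmt-PneNP-18538) — objects of the line `lrad-gluing`

Definitions file for the crux line `lrad-gluing` (skeleton
`Summits/PneNP/PneNP/Cruxes/StrongComposition/Lines/lrad_gluing.lean`, planner pnp-ideate-p4 g19; CLOSED by the
lead prover, crux-write commit 5a5f8789ebd3).  The line proves the RUNG `StrongCompositionLRAD`: the crux C1
`Summit.PneNP.PneNP.Theses.KrwChromaticSteering.StrongComposition` (Meir's strong composition with `γ = 1`)
VERBATIM, restricted to protocols of the DISCIPLINED class LRAD — every node test is a label test, an affine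
(parity) test, or a single-row test, and along every root–leaf path no row carries both an affine test and a
single-row test (rows are typed `algebraic` / `combinatorial` online at first touch).  The rung is implied by C1
(`lrad_of_strongComposition`) and contains both classes on which C1 was proved before (M3 = label ∨ public-row
tests, L⁺ = label ∨ affine tests).

Crux workfiles are not importable modules, so this file carries the line's OBJECTS VERBATIM (declaration bodies
byte-identical to their namesakes in `…Cruxes.StrongComposition.LradGluing`), for the proof files
`KrwChromaticSteeringStrongCompositionLrad*.lean` to share:

* §1 rectangles of a Karchmer–Wigderson game (`SolvesRect`, `Hard`);
* §2 the class LRAD (`parityOn`, `IsAffineTest`, `IsLabelTest`, `IsRowTest`, `RowType`, `touchedRows`, `retag`,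
  `NodeOK`, `LRADisciplinedOn`, `LRADisciplined`), the rung `StrongCompositionLRAD` and `lrad_of_strongComposition`;
* §3 affine systems with PER-ROW budgets (`AffSys`, `Sat`, `rowParity`, `AffGeneric`, `eqRows`, `rowLoad`,
  `PerRowLU`, `PerRowLUOfGeneric`, row surgery `setRow`, `rowSupp`, `offRow`, `restrictRow`, `touching`);
* §4 the quantitative adversary statement `LRADQuantitative` (the line's single registered stub);
* §5 the adversary's STATE vocabulary (M3's `AE`, `RA`, `Alive`, `cst`, `rowChild`, fibred over a common affine
  system: `XSetE`, `ValidOnE`, `StateOK`) and the glued invariant `InvAt` (potential `ℓ + min K k`).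

No theorem of substance is proved here.  Honest framing: the rung is a CLASS-RESTRICTED form of Meir's open
problem (strong composition with `γ = 1`, [Meir2023] = O. Meir, *Toward better depth lower bounds: a KRW-like
theorem for strong composition*, FOCS 2023 / arXiv:2306.00615); C1 itself stays open and nothing in this file
bears on P vs NP.
-/

set_option linter.dupNamespace false -- `Summit.PneNP.PneNP.…`: summit = sub-problem name (D-0017 single-conjunct layout)
set_option autoImplicit false

namespace Summit.PneNP.PneNP.Theorems.KrwLrad

open Literature.Computability.Complexity

universe u

/-! ## §1  Rectangles of a Karchmer–Wigderson game -/

section Rect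

variable {ι : Type u}

/-- The tree `Q` solves the Karchmer–Wigderson game on the rectangle `A × B`: on every `a ∈ A`, `b ∈ B`
it outputs a coordinate where they differ.  VERBATIM the skeleton's `SolvesRect`.
[cite: Meir2023, §2.3 (KW relations of rectangles)] -/
def SolvesRect (Q : KWTree ι) (A B : Set (ι → Bool)) : Prop :=
  ∀ a ∈ A, ∀ b ∈ B, a (Q.run a b) ≠ b (Q.run a b)

/-- `Hard A B ℓ`: every tree solving `A × B` has depth `≥ ℓ` (a lower bound on the communication
complexity `C(A × B)`, stated without `sInf`).  VERBATIM the skeleton's `Hard`. -/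
def Hard (A B : Set (ι → Bool)) (ℓ : ℕ) : Prop :=
  ∀ Q : KWTree ι, SolvesRect Q A B → ℓ ≤ Q.depth

end Rect

/-! ## §2  The disciplined class LRAD and the rung -/

section Discipline

variable {m n : ℕ}

/-- Parity of the entries of `X` on the support `S ⊆ [m] × [n]`. -/
def parityOn (S : Finset (Fin m × Fin n)) (X : Fin m × Fin n → Bool) : Bool :=
  Nat.bodd (S.filter fun p => X p = true).card

/-- An AFFINE node test: `X ↦ c ⊕ ⨁_{p ∈ S} X p` for some support `S` (any rows) and constant `c`. -/
def IsAffineTest (s : (Fin m × Fin n → Bool) → Bool) : Prop :=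
  ∃ (S : Finset (Fin m × Fin n)) (c : Bool), ∀ X, s X = Bool.xor c (parityOn S X)

/-- A LABEL node test: a function of the own label vector `(g(X₁), …, g(X_m))` only. -/
def IsLabelTest (g : (Fin n → Bool) → Bool) (s : (Fin m × Fin n → Bool) → Bool) : Prop :=
  ∃ φ : (Fin m → Bool) → Bool, ∀ X, s X = φ (rowLabels g X)

/-- A SINGLE-ROW node test: a function of one own row `X_i`, `i` fixed at the node. -/
def IsRowTest (s : (Fin m × Fin n → Bool) → Bool) : Prop :=
  ∃ (i : Fin m) (ψ : (Fin n → Bool) → Bool), ∀ X, s X = ψ (row X i)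

/-- The type a root–leaf path assigns to a row online: untouched, algebraic (met by an affine test),
combinatorial (met by a single-row test). -/
inductive RowType
  | fresh
  | algebraic
  | combinatorial
  deriving DecidableEq

/-- The rows an affine support `S` touches. -/
def touchedRows (S : Finset (Fin m × Fin n)) : Finset (Fin m) := S.image Prod.fst

/-- Retyping below an affine node: touched rows become `algebraic`. -/
def retag (S : Finset (Fin m × Fin n)) (τ : Fin m → RowType) : Fin m → RowType :=
  fun i => if i ∈ touchedRows S then RowType.algebraic else τ i

/-- One node of the disciplined class LRAD relative to an online typing `τ`: the test `s` is a label
test (typing unchanged), OR an affine test whose support avoids `combinatorial` rows (touched rows become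
`algebraic` below it), OR a single-row test on a row that is not `algebraic` (it becomes `combinatorial`
below it); `τ'` is the typing below the node. -/
def NodeOK (g : (Fin n → Bool) → Bool) (τ : Fin m → RowType) (s : (Fin m × Fin n → Bool) → Bool)
    (τ' : Fin m → RowType) : Prop :=
  (IsLabelTest g s ∧ τ' = τ) ∨
  (∃ (S : Finset (Fin m × Fin n)) (c : Bool), (∀ X, s X = Bool.xor c (parityOn S X)) ∧
      (∀ i ∈ touchedRows S, τ i ≠ .combinatorial) ∧ τ' = retag S τ) ∨
  (∃ (i : Fin m) (ψ : (Fin n → Bool) → Bool), (∀ X, s X = ψ (row X i)) ∧ τ i ≠ .algebraic ∧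
      τ' = Function.update τ i .combinatorial)

/-- **Class LRAD** from the typing `τ`: every node is `NodeOK` at the typing reaching it (along every
root–leaf path no row carries both a single-row test and an affine test). -/
def LRADisciplinedOn (g : (Fin n → Bool) → Bool) : (Fin m → RowType) → KWTree (Fin m × Fin n) → Prop
  | _, .leaf _ => True
  | τ, .alice s P Q => ∃ τ', NodeOK g τ s τ' ∧ LRADisciplinedOn g τ' P ∧ LRADisciplinedOn g τ' Q
  | τ, .bob s P Q => ∃ τ', NodeOK g τ s τ' ∧ LRADisciplinedOn g τ' P ∧ LRADisciplinedOn g τ' Q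

/-- Disciplined from the all-`fresh` typing. -/
def LRADisciplined (g : (Fin n → Bool) → Bool) (P : KWTree (Fin m × Fin n)) : Prop :=
  LRADisciplinedOn g (fun _ => RowType.fresh) P

/-- **The rung C1|LRAD**: the crux `StrongComposition` verbatim (`g` existential, loss `O(log mn)`),
restricted to disciplined protocols.  VERBATIM the skeleton's registered target `StrongCompositionLRAD`. -/
def StrongCompositionLRAD : Prop :=
  ∃ c : ℕ, ∀ m n : ℕ, 1 ≤ n → ∀ f : (Fin m → Bool) → Bool, (∃ a b, f a ≠ f b) →
    ∃ g : (Fin n → Bool) → Bool, ∀ P : KWTree (Fin m × Fin n), LRADisciplined g P → P.SolvesStrong f g →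
      ∃ Q : KWTree (Fin m), Q.Solves f ∧ Q.depth + n ≤ P.depth + c * (Nat.log 2 (m * n) + 1)

end Discipline

/-! ## §3  Affine systems with per-row budgets; row surgery -/

section PerRowBudget

variable {m n : ℕ}

/-- A system of parity equations on `m × n` matrices: pairs (support, right-hand side). -/
abbrev AffSys (m n : ℕ) := List (Finset (Fin m × Fin n) × Bool)

/-- `X` satisfies every equation of `E`. -/
def Sat (E : AffSys m n) (X : Fin m × Fin n → Bool) : Prop := ∀ e ∈ E, parityOn e.1 X = e.2

/-- Parity of `x` on a support `S ⊆ [n]` (one row). -/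
def rowParity (S : Finset (Fin n)) (x : Fin n → Bool) : Bool := Nat.bodd (S.filter fun j => x j = true).card

/-- `r`-affine-genericity of `g` by equations: inside every satisfiable system of at most `n − r − 1` row
equations `g` takes both values. -/
def AffGeneric (g : (Fin n → Bool) → Bool) (r : ℕ) : Prop :=
  ∀ E : List (Finset (Fin n) × Bool), E.length + r + 1 ≤ n →
    (∃ x, ∀ e ∈ E, rowParity e.1 x = e.2) → ∀ β : Bool, ∃ x, (∀ e ∈ E, rowParity e.1 x = e.2) ∧ g x = β

/-- The rows an equation support touches. -/
def eqRows (S : Finset (Fin m × Fin n)) : Finset (Fin m) := S.image Prod.fst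

/-- ROW LOAD: the number of equations of `E` whose support meets row `i`. -/
def rowLoad (E : AffSys m n) (i : Fin m) : ℕ := (E.filter fun e => i ∈ eqRows e.1).length

/-- **Label-universality with a per-row budget** `q`: every satisfiable system touching each row at most
`q` times has, for every label vector, a solution carrying those labels. -/
def PerRowLU (g : (Fin n → Bool) → Bool) (m q : ℕ) : Prop :=
  ∀ E : AffSys m n, (∀ i, rowLoad E i ≤ q) → (∃ X, Sat E X) →
    ∀ v : Fin m → Bool, ∃ X, Sat E X ∧ rowLabels g X = v

/-- Support statement S3 of the line: an `r`-generic non-constant `g` is label-universal with per-row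
budget `n − r − 1`, for every number of rows (proved in `…LradRealisability.lean`). -/
def PerRowLUOfGeneric : Prop :=
  ∀ (m n r : ℕ) (g : (Fin n → Bool) → Bool), (∃ u v, g u = true ∧ g v = false) →
    AffGeneric g r → PerRowLU g m (n - r - 1)

/-- Replace row `i` of `X` by `y`. -/
def setRow (X : Fin m × Fin n → Bool) (i : Fin m) (y : Fin n → Bool) : Fin m × Fin n → Bool :=
  fun p => if p.1 = i then y p.2 else X p

/-- The row-`i` part of a support, as a subset of `[n]`. -/
def rowSupp (S : Finset (Fin m × Fin n)) (i : Fin m) : Finset (Fin n) :=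
  (S.filter fun p => p.1 = i).image Prod.snd

/-- The off-row-`i` part of a support. -/
def offRow (S : Finset (Fin m × Fin n)) (i : Fin m) : Finset (Fin m × Fin n) :=
  S.filter fun p => p.1 ≠ i

/-- The system `E` restricted to row `i`, the other rows frozen at `X`. -/
def restrictRow (E : AffSys m n) (i : Fin m) (X : Fin m × Fin n → Bool) :
    List (Finset (Fin n) × Bool) :=
  E.map fun e => (rowSupp e.1 i, Bool.xor e.2 (parityOn (offRow e.1 i) X))

/-- The equations of `E` touching row `i`. -/
def touching (E : AffSys m n) (i : Fin m) : AffSys m n := E.filter fun e => i ∈ eqRows e.1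

end PerRowBudget

/-! ## §4  The quantitative adversary statement (the line's registered stub) -/

/-- `LRADQuantitative` (the line's single registered stub, proved in `…LradQuantitative.lean`): for a
non-constant outer `f` whose KW rectangle `f⁻¹1 × f⁻¹0` is `ℓ`-hard, an inner `g` of KW-depth `≥ dg` that is
label-universal with per-row budget `q ≥ 1`, every disciplined protocol for the strong composition game
`KW_f ⊛ KW_g` has depth `≥ ℓ + min(dg, q − 1) − 2`.  VERBATIM the skeleton's `LRADQuantitative`. -/
def LRADQuantitative : Prop :=
  ∀ (m n q dg ℓ : ℕ) (f : (Fin m → Bool) → Bool) (g : (Fin n → Bool) → Bool),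
    (∃ a b, f a = true ∧ f b = false) →
    (∀ R : KWTree (Fin n), R.Solves g → dg ≤ R.depth) → PerRowLU g m q → 1 ≤ q →
    Hard (f ⁻¹' {true}) (f ⁻¹' {false}) ℓ →
    ∀ P : KWTree (Fin m × Fin n), LRADisciplined g P → P.SolvesStrong f g →
      ℓ + min dg (q - 1) ≤ P.depth + 2

/-! ## §5  The adversary's state (M3's label/row-set bookkeeping fibred over a common affine system) -/

section State

variable {m n : ℕ}
variable (g : (Fin n → Bool) → Bool)

/-- The matrices one player may still hold: label column in `A`, row `i` in `S i`, and `X ⊨ E`. -/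
def XSetE (A : Set (Fin m → Bool)) (S : Fin m → Set (Fin n → Bool)) (E : AffSys m n) :
    Set (Fin m × Fin n → Bool) :=
  {X | rowLabels g X ∈ A ∧ (∀ i, row X i ∈ S i) ∧ Sat E X}

/-- The REALISABLE label columns: those of `A` every coordinate of which is the `g`-value of an allowed row. -/
def AE (A : Set (Fin m → Bool)) (S : Fin m → Set (Fin n → Bool)) : Set (Fin m → Bool) :=
  {a | a ∈ A ∧ ∀ i, ∃ x ∈ S i, g x = a i}

/-- One side of the row game of row `i` at orientation value `α`: allowed rows with `g`-value `α`. -/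
def RA (S : Fin m → Set (Fin n → Bool)) (i : Fin m) (α : Bool) : Set (Fin n → Bool) :=
  S i ∩ {x | g x = α}

/-- Orientation `(i, α)` (final row `i` with `a_i = α`, `b_i = ¬α`) is still possible. -/
def Alive (A B : Set (Fin m → Bool)) (S T : Fin m → Set (Fin n → Bool)) (i : Fin m) (α : Bool) : Prop :=
  (∃ a ∈ AE g A S, a i = α) ∧ (∃ b ∈ AE g B T, b i = !α)

/-- `1` if all vectors of `E` agree at coordinate `i` (in particular if `E = ∅`), else `0`. -/
noncomputable def cst (E : Set (Fin m → Bool)) (i : Fin m) : ℕ := by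
  classical exact if ∃ v, ∀ a ∈ E, a i = v then 1 else 0

/-- `P` is correct for the strong game on all input pairs the fibred state allows. -/
def ValidOnE (P : KWTree (Fin m × Fin n)) (A B : Set (Fin m → Bool)) (S T : Fin m → Set (Fin n → Bool))
    (E : AffSys m n) : Prop :=
  ∀ X ∈ XSetE g A S E, ∀ Y ∈ XSetE g B T E,
    X (P.run X Y) ≠ Y (P.run X Y) ∧ rowLabels g X (P.run X Y).1 ≠ rowLabels g Y (P.run X Y).1

/-- Typing discipline of a state: only algebraic rows carry equations, only combinatorial rows carry
row-sets. -/
def StateOK (τ : Fin m → RowType) (S T : Fin m → Set (Fin n → Bool)) (E : AffSys m n) : Prop :=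
  ∀ i, (τ i ≠ RowType.algebraic → rowLoad E i = 0) ∧
    (τ i ≠ RowType.combinatorial → S i = Set.univ ∧ T i = Set.univ)

/-- Row test on row `i` with bit `ψ`, answer `β`: shrink `S i`. -/
def rowChild (S : Fin m → Set (Fin n → Bool)) (i : Fin m) (ψ : (Fin n → Bool) → Bool) (β : Bool) :
    Fin m → Set (Fin n → Bool) :=
  Function.update S i (S i ∩ {x | ψ x = β})

/-- **The glued invariant** at typing `τ` for a subtree `P` (M3's invariant over the fibred state, plus a
budget): for every state compatible with `τ` on which `P` is correct — common system `E` satisfiable with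
`rowLoad E i + k ≤ q` on every row, realisable label rectangle `ℓ`-hard, alive row games `r`-hard with
`K ≤ r + #(constant sides)` — the potential bound `ℓ + min K k ≤ depth P + 2` holds. -/
def InvAt (q : ℕ) (τ : Fin m → RowType) (P : KWTree (Fin m × Fin n)) : Prop :=
  ∀ (A B : Set (Fin m → Bool)) (S T : Fin m → Set (Fin n → Bool)) (E : AffSys m n) (k : ℕ),
    StateOK τ S T E → (∃ X, Sat E X) → (∀ i, rowLoad E i + k ≤ q) →
    ValidOnE g P A B S T E → (∀ a ∈ AE g A S, ∀ b ∈ AE g B T, a ≠ b) →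
    (AE g A S).Nonempty → (AE g B T).Nonempty →
    ∀ (ℓ K : ℕ) (r : Fin m → Bool → ℕ), Hard (AE g A S) (AE g B T) ℓ →
      (∀ i α, Alive g A B S T i α → Hard (RA g S i α) (RA g T i (!α)) (r i α)) →
      (∀ i α, Alive g A B S T i α → K ≤ r i α + cst (AE g A S) i + cst (AE g B T) i) →
      ℓ + min K k ≤ P.depth + 2

end State

end Summit.PneNP.PneNP.Theorems.KrwLrad
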